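import Mathlib
import HarnessLib

/-!
# Bonds of the soft link do not cross

Route `PricedLinkCensus`, item `SoftFourRings` (stmt-AtomisticToContinuum-14234), evidence
`softrings-search.md` §5 step (1) / §11.  In the angular window of `softFourRings_of_twelve_unit`
(bonded directions at inner product `≥ cb = cos 60.66°`, distinct directions at inner product
`≤ ca = cos 59.35°`) two bonds with four distinct endpoints cannot cross on the sphere, and a bond
cannot pass through a third direction: the closed convex cones `cone(a, b)` and `cone(c, d)` spanned by
two bonds meet only at the origin as soon as `2 ca < 1 + cb` — a margin of `0.47` at `η = 1/100`.
This is the geometric input ("the radial projection of the link graph is a plane drawing") of the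
planar-map step of the blueprint; the missing piece downstream is Euler's formula for such geodesic
nets on `S²`, which Mathlib does not have.

Proof: for `p = α a + β b = γ c + δ d` with nonnegative coefficients,
`‖p‖² ≥ (1+cb)/2 · (α+β)²`, `‖p‖² ≥ (1+cb)/2 · (γ+δ)²` (since `⟪a,b⟫, ⟪c,d⟫ ≥ cb`) while
`‖p‖² = ⟪α a + β b, γ c + δ d⟫ ≤ ca (α+β)(γ+δ)`; AM–GM gives `((1+cb)/2 − ca)(α+β)(γ+δ) ≤ 0`.
-/

namespace Summit.AtomisticToContinuum.Crystallization.Theorems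

open Real RealInnerProductSpace

/-- **Bond cones meet only at the origin.**  Let `−1 < cb`, `2 ca < 1 + cb`, and let `a, b, c, d`
be unit vectors with `cb ≤ ⟪a, b⟫`, `cb ≤ ⟪c, d⟫` (two bonds) and `⟪a, c⟫, ⟪a, d⟫, ⟪b, c⟫,
⟪b, d⟫ ≤ ca` (the endpoints of different bonds are separated; `c = d` is allowed, covering a bond
through a vertex).  If `α a + β b = γ c + δ d` with `α, β, γ, δ ≥ 0` then all four coefficients
vanish: the geodesic arcs `ab` and `cd` are disjoint. [folklore] -/
theorem bond_cones_disjoint {ca cb : ℝ} (hcb : -1 < cb) (h : 2 * ca < 1 + cb)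
    {a b c d : EuclideanSpace ℝ (Fin 3)} (ha : ‖a‖ = 1) (hb : ‖b‖ = 1) (hc : ‖c‖ = 1)
    (hd : ‖d‖ = 1) (hab : cb ≤ ⟪a, b⟫) (hcd : cb ≤ ⟪c, d⟫) (hac : ⟪a, c⟫ ≤ ca)
    (had : ⟪a, d⟫ ≤ ca) (hbc : ⟪b, c⟫ ≤ ca) (hbd : ⟪b, d⟫ ≤ ca) {α β γ δ : ℝ} (hα : 0 ≤ α)
    (hβ : 0 ≤ β) (hγ : 0 ≤ γ) (hδ : 0 ≤ δ) (heq : α • a + β • b = γ • c + δ • d) :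
    α = 0 ∧ β = 0 ∧ γ = 0 ∧ δ = 0 := by
  have haa : ⟪a, a⟫ = 1 := by rw [real_inner_self_eq_norm_sq, ha]; norm_num
  have hbb : ⟪b, b⟫ = 1 := by rw [real_inner_self_eq_norm_sq, hb]; norm_num
  have hcc : ⟪c, c⟫ = 1 := by rw [real_inner_self_eq_norm_sq, hc]; norm_num
  have hdd : ⟪d, d⟫ = 1 := by rw [real_inner_self_eq_norm_sq, hd]; norm_num
  -- three expressions for `P = ‖α a + β b‖²`
  obtain ⟨P, hP⟩ : ∃ P : ℝ, P = ⟪α • a + β • b, α • a + β • b⟫ := ⟨_, rfl⟩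
  have hP1 : P = α ^ 2 + β ^ 2 + 2 * (α * β * ⟪a, b⟫) := by
    rw [hP]
    simp only [inner_add_left, inner_add_right, real_inner_smul_left, real_inner_smul_right,
      haa, hbb]
    rw [real_inner_comm a b]; ring
  have hP2 : P = γ ^ 2 + δ ^ 2 + 2 * (γ * δ * ⟪c, d⟫) := by
    rw [hP, heq]
    simp only [inner_add_left, inner_add_right, real_inner_smul_left, real_inner_smul_right,
      hcc, hdd]
    rw [real_inner_comm c d]; ring
  have hP3 : P = α * γ * ⟪a, c⟫ + α * δ * ⟪a, d⟫ + β * γ * ⟪b, c⟫ + β * δ * ⟪b, d⟫ := by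
    rw [hP, show ⟪α • a + β • b, α • a + β • b⟫ = ⟪α • a + β • b, γ • c + δ • d⟫ from by
      rw [← heq]]
    simp only [inner_add_left, inner_add_right, real_inner_smul_left, real_inner_smul_right]
    ring
  -- lower bounds `(1+cb)/2 · (α+β)² ≤ P`, `(1+cb)/2 · (γ+δ)² ≤ P`
  have f1 : α * β * cb ≤ α * β * ⟪a, b⟫ := mul_le_mul_of_nonneg_left hab (mul_nonneg hα hβ)
  have f2 : 0 ≤ (1 - cb) * (α - β) ^ 2 := by
    have : cb ≤ 1 := by
      have h1 := real_inner_le_norm a b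
      rw [ha, hb, mul_one] at h1
      exact hab.trans h1
    exact mul_nonneg (by linarith) (sq_nonneg _)
  have hlow1 : (1 + cb) / 2 * (α + β) ^ 2 ≤ P := by
    have e : P - (1 + cb) / 2 * (α + β) ^ 2 =
        2 * (α * β * ⟪a, b⟫ - α * β * cb) + (1 - cb) * (α - β) ^ 2 / 2 := by
      rw [hP1]; ring
    have : 0 ≤ P - (1 + cb) / 2 * (α + β) ^ 2 := by
      rw [e]; exact add_nonneg (by linarith only [f1]) (by linarith only [f2])
    linarith only [this]
  have g1 : γ * δ * cb ≤ γ * δ * ⟪c, d⟫ := mul_le_mul_of_nonneg_left hcd (mul_nonneg hγ hδ)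
  have g2 : 0 ≤ (1 - cb) * (γ - δ) ^ 2 := by
    have : cb ≤ 1 := by
      have h1 := real_inner_le_norm c d
      rw [hc, hd, mul_one] at h1
      exact hcd.trans h1
    exact mul_nonneg (by linarith) (sq_nonneg _)
  have hlow2 : (1 + cb) / 2 * (γ + δ) ^ 2 ≤ P := by
    have e : P - (1 + cb) / 2 * (γ + δ) ^ 2 =
        2 * (γ * δ * ⟪c, d⟫ - γ * δ * cb) + (1 - cb) * (γ - δ) ^ 2 / 2 := by
      rw [hP2]; ring
    have : 0 ≤ P - (1 + cb) / 2 * (γ + δ) ^ 2 := by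
      rw [e]; exact add_nonneg (by linarith only [g1]) (by linarith only [g2])
    linarith only [this]
  -- upper bound `P ≤ ca (α+β)(γ+δ)`
  have u1 : α * γ * ⟪a, c⟫ ≤ α * γ * ca := mul_le_mul_of_nonneg_left hac (mul_nonneg hα hγ)
  have u2 : α * δ * ⟪a, d⟫ ≤ α * δ * ca := mul_le_mul_of_nonneg_left had (mul_nonneg hα hδ)
  have u3 : β * γ * ⟪b, c⟫ ≤ β * γ * ca := mul_le_mul_of_nonneg_left hbc (mul_nonneg hβ hγ)
  have u4 : β * δ * ⟪b, d⟫ ≤ β * δ * ca := mul_le_mul_of_nonneg_left hbd (mul_nonneg hβ hδ)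
  have hup : P ≤ ca * ((α + β) * (γ + δ)) := by
    have e : ca * ((α + β) * (γ + δ)) = α * γ * ca + α * δ * ca + β * γ * ca + β * δ * ca := by
      ring
    rw [e, hP3]; linarith only [u1, u2, u3, u4]
  -- AM–GM: `(1+cb)/2 · (α+β)(γ+δ) ≤ P`, hence `(α+β)(γ+δ) = 0`
  have hm : 0 < (1 + cb) / 2 := by linarith only [hcb]
  have hmid : (1 + cb) / 2 * ((α + β) * (γ + δ)) ≤ P := by
    have e : P - (1 + cb) / 2 * ((α + β) * (γ + δ)) = (P - (1 + cb) / 2 * (α + β) ^ 2) / 2 +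
        (P - (1 + cb) / 2 * (γ + δ) ^ 2) / 2 + (1 + cb) / 2 * ((α + β) - (γ + δ)) ^ 2 / 2 := by
      ring
    have : 0 ≤ P - (1 + cb) / 2 * ((α + β) * (γ + δ)) := by
      rw [e]
      refine add_nonneg (add_nonneg (by linarith only [hlow1]) (by linarith only [hlow2])) ?_
      exact div_nonneg (mul_nonneg hm.le (sq_nonneg _)) zero_le_two
    linarith only [this]
  have hST0 : 0 ≤ (α + β) * (γ + δ) :=
    mul_nonneg (add_nonneg hα hβ) (add_nonneg hγ hδ)
  have hST : (α + β) * (γ + δ) = 0 := by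
    by_contra hne
    have hpos : 0 < (α + β) * (γ + δ) := lt_of_le_of_ne hST0 (Ne.symm hne)
    have h3 : ca * ((α + β) * (γ + δ)) < (1 + cb) / 2 * ((α + β) * (γ + δ)) :=
      mul_lt_mul_of_pos_right (by linarith only [h]) hpos
    linarith only [hmid, hup, h3]
  have hP0 : P ≤ 0 := by rw [hST, mul_zero] at hup; exact hup
  have hS : α + β = 0 := by
    have h1 : (1 + cb) / 2 * (α + β) ^ 2 ≤ 0 := hlow1.trans hP0
    have h2 : (α + β) ^ 2 ≤ 0 := by
      by_contra hne
      exact absurd h1 (not_le.mpr (mul_pos hm (not_le.mp hne)))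
    exact pow_eq_zero_iff two_ne_zero |>.mp (le_antisymm h2 (sq_nonneg _))
  have hT : γ + δ = 0 := by
    have h1 : (1 + cb) / 2 * (γ + δ) ^ 2 ≤ 0 := hlow2.trans hP0
    have h2 : (γ + δ) ^ 2 ≤ 0 := by
      by_contra hne
      exact absurd h1 (not_le.mpr (mul_pos hm (not_le.mp hne)))
    exact pow_eq_zero_iff two_ne_zero |>.mp (le_antisymm h2 (sq_nonneg _))
  exact ⟨by linarith only [hS, hα, hβ], by linarith only [hS, hα, hβ],
    by linarith only [hT, hγ, hδ], by linarith only [hT, hγ, hδ]⟩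

/-- **No crossing at `η = 1/100`.**  In the angular window of `softFourRings_of_twelve_unit`
(`ca = 1 − 1/(2·(101/100)²) ≈ cos 59.35°`, `cb = 1 − (101/100)²/2 ≈ cos 60.66°`) two bonds with
separated endpoints span cones meeting only at `0`; here `1 + cb − 2 ca ≈ 0.47`. [folklore] -/
theorem bond_cones_disjoint_one_percent {a b c d : EuclideanSpace ℝ (Fin 3)} (ha : ‖a‖ = 1)
    (hb : ‖b‖ = 1) (hc : ‖c‖ = 1) (hd : ‖d‖ = 1)
    (hab : (1 - (101 / 100 : ℝ) ^ 2 / 2) ≤ ⟪a, b⟫) (hcd : (1 - (101 / 100 : ℝ) ^ 2 / 2) ≤ ⟪c, d⟫)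
    (hac : ⟪a, c⟫ ≤ 1 - 1 / (2 * (101 / 100 : ℝ) ^ 2))
    (had : ⟪a, d⟫ ≤ 1 - 1 / (2 * (101 / 100 : ℝ) ^ 2))
    (hbc : ⟪b, c⟫ ≤ 1 - 1 / (2 * (101 / 100 : ℝ) ^ 2))
    (hbd : ⟪b, d⟫ ≤ 1 - 1 / (2 * (101 / 100 : ℝ) ^ 2)) {α β γ δ : ℝ} (hα : 0 ≤ α)
    (hβ : 0 ≤ β) (hγ : 0 ≤ γ) (hδ : 0 ≤ δ) (heq : α • a + β • b = γ • c + δ • d) :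
    α = 0 ∧ β = 0 ∧ γ = 0 ∧ δ = 0 :=
  bond_cones_disjoint (ca := 1 - 1 / (2 * (101 / 100 : ℝ) ^ 2)) (cb := 1 - (101 / 100 : ℝ) ^ 2 / 2)
    (by norm_num) (by norm_num) ha hb hc hd hab hcd hac had hbc hbd hα hβ hγ hδ heq

end Summit.AtomisticToContinuum.Crystallization.Theorems
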